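import Summits.ResolutionOfSingularities.ResolutionOfSingularities.Theorems.HomologicalConductorNoZenoGaloisFibreTransitive
import Summits.ResolutionOfSingularities.ResolutionOfSingularities.Theorems.HomologicalConductorNoZenoFibreSymmetry
import Summits.ResolutionOfSingularities.ResolutionOfSingularities.Theorems.HomologicalConductorNoZenoBaseChangeAutomorphism
import Summits.ResolutionOfSingularities.ResolutionOfSingularities.Theorems.HomologicalConductorNoZenoSpecResidueField
import Summits.ResolutionOfSingularities.ResolutionOfSingularities.Theorems.HomologicalConductorNoZenoExcCurvesBaseChange
import HarnessLib

/-!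
# Crux `NoZenoR` (stmt-ResolutionOfSingularities-19943), β layer, `stub_L1wCoreF` descent brick: BC-4b hypothesis (T) DISCHARGED
# — the lifted automorphisms of the Galois splitting germ are transitive on the fibres of `X ×_S Spec Ŝ → X`

Route `ResolutionOfSingularities/HomologicalConductor`, crux chain W4.4.  OURS (cell res-hironaka, seat res-L0-w44-stub-2,
(L1)-PREP v4 §2 / planner (ρ48)); AI-written, weaker than expert review; nothing here is a statement of the manuscript
under review (Hironaka 2017).  Def-free, fact-free, `--supports 19943 --as helper`.

Setting: `S → Ŝ` a local homomorphism of local rings with `𝔪_S Ŝ = 𝔪_Ŝ` and `κ(Ŝ)/κ(S)` finite GALOIS, a group `H`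
acting on `Ŝ` by `S`-algebra automorphisms (`ρ : H →* (Ŝ ≃ₐ[S] Ŝ)`) such that every `κ(S)`-automorphism of `κ(Ŝ)` is
the residue map of some `ρ h` (res-D-pv-039's `…SplitGaloisSymmetry` / `…SplitGaloisTower.exists_galoisGerm`), and
`π : X → Spec S`.  For `X_B := X ×_S Spec Ŝ` (Mathlib `pullback π ι`, `ι = Spec (S → Ŝ)`):

* **`exists_iso_apply_eq_of_residue_surjective`** — for points `ζ, ζ'` of `X_B` over the SAME point `x ∈ X` lying
  over the closed point of `S`, some lift `e_h : X_B ≅ X_B` (`…NoZenoBaseChangeAutomorphism`) of some `ρ h` maps `ζ` to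
  `ζ'`, with `e_h ≫ fst = fst` and `e_h ≫ snd = snd ≫ Spec (ρ h)`;
* **`hsymm_of_residue_surjective`** — the hypothesis `hsymm` of
  `…NoZenoGaloisAscent.isMinimalResolution_of_flat_of_symmetric`, verbatim, for this `X_B`.

Proof: the fibre of `X_B → X` over `x` is `Spec (κ(x) ⊗_{κ(S)} κ(Ŝ))` (`…NoZenoFibreSymmetry`), on which `e_h` acts
through `id ⊗ (ρ h)‾`; these are all of `id ⊗ Gal(κ(Ŝ)/κ(S))`, which is transitive (`…NoZenoGaloisFibreTransitive`,
res-D-pv-039's `exists_algEquiv_map_eq_of_isPrime`).  The glue lemmas identify the residue endomorphism of `Spec θ`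
at the closed point with `ResidueField.map θ` (`residueFieldMapFixed_comp_iso`).

References: A. Grothendieck, EGA I (1971) §3.4–3.5 [folklore]; N. Bourbaki, *Alg. Comm.* V §2 no. 2 [folklore].
-/

noncomputable section

-- single-problem summit: the doubled namespace component `ResolutionOfSingularities` is forced
set_option linter.dupNamespace false

namespace Summit.ResolutionOfSingularities.ResolutionOfSingularities.Theorems.NoZeno.ExcCount

open CategoryTheory AlgebraicGeometry Limits Scheme.Pullback IsLocalRing

universe u

/-! ## Glue: residue endomorphisms at a fixed point, explicitly -/

section Fixed

variable {Y S' : Scheme.{u}} {g : Y ⟶ S'}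

/-- `Γ(Y) → κ(y₂) ≅ κ(y₁)` is `Γ(Y) → κ(y₁)` for `y₁ = y₂`. [folklore] -/
@[reassoc]
theorem Γevaluation_comp_residueFieldCongr_inv {y₁ y₂ : Y} (e : y₁ = y₂) :
    Y.Γevaluation y₂ ≫ (Y.residueFieldCongr e).inv = Y.Γevaluation y₁ := by
  subst e
  exact Category.comp_id _

/-- The explicit residue endomorphism `ū = κ(y) ≅ κ(u y) → κ(y)` of an endomorphism `u` at a fixed point `y`
satisfies `Spec ū ≫ (Spec κ(y) → Y) = (Spec κ(y) → Y) ≫ u`. [folklore] -/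
theorem specMap_residueFieldMapFixed_comp (u : Y ⟶ Y) {y : Y} (hy : u.base y = y) :
    Spec.map ((Y.residueFieldCongr hy).inv ≫ u.residueFieldMap y) ≫ Y.fromSpecResidueField y =
      Y.fromSpecResidueField y ≫ u := by
  rw [Spec.map_comp, Category.assoc, Scheme.residueFieldCongr_inv, Scheme.residueFieldCongr_fromSpecResidueField,
    Scheme.Hom.SpecMap_residueFieldMap_fromSpecResidueField]

/-- … and is compatible with `κ(g y) → κ(y)` when `u` is over `S'`. [folklore] -/
theorem residueFieldMap_comp_residueFieldMapFixed (u : Y ⟶ Y) (hu : u ≫ g = g) {y : Y} (hy : u.base y = y) :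
    g.residueFieldMap y ≫ ((Y.residueFieldCongr hy).inv ≫ u.residueFieldMap y) = g.residueFieldMap y := by
  have h1 : (u ≫ g).residueFieldMap y = g.residueFieldMap (u.base y) ≫ u.residueFieldMap y :=
    Scheme.residueFieldMap_comp u g y
  have h2 : (u ≫ g).residueFieldMap y =
      (S'.residueFieldCongr (congrArg g.base hy : g.base (u.base y) = g.base y)).hom ≫ g.residueFieldMap y :=
    Scheme.Hom.residueFieldMap_congr hu y
  have h3 : g.residueFieldMap (u.base y) ≫ (Y.residueFieldCongr hy).hom =
      (S'.residueFieldCongr (congrArg g.base hy)).hom ≫ g.residueFieldMap y :=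
    Scheme.Hom.residueFieldMap_congr' hy
  have h4 : g.residueFieldMap y ≫ (Y.residueFieldCongr hy).inv =
      (S'.residueFieldCongr (congrArg g.base hy)).inv ≫ g.residueFieldMap (u.base y) := by
    rw [Iso.comp_inv_eq, Category.assoc, h3, Iso.inv_hom_id_assoc]
  rw [← Category.assoc, h4, Category.assoc, ← h1, h2, Iso.inv_hom_id_assoc]

end Fixed

/-! ## Glue: on `Spec` of a local ring, the residue endomorphism of `Spec θ` at the closed point is `κ(θ)` -/

section SpecLocal

variable (R : Type u) [CommRing R] [IsLocalRing R]

/-- An automorphism of a ring is a local homomorphism. [folklore] -/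
theorem isLocalHom_ringEquiv {A B : Type*} [CommRing A] [CommRing B] (θ : A ≃+* B) : IsLocalHom θ.toRingHom :=
  ⟨fun a ha => by simpa using ha.map θ.symm.toRingHom⟩

/-- `Spec θ` fixes the closed point, for `θ` a local endomorphism of a local ring. [folklore] -/
theorem specMap_base_closedPoint (θ : R →+* R) [IsLocalHom θ] :
    (Spec.map (CommRingCat.ofHom θ)).base (closedPoint R) = closedPoint R :=
  IsLocalRing.comap_closedPoint θ

/-- **The residue endomorphism of `Spec θ` at the closed point is `ResidueField.map θ`** under any identification
`κ(𝔪) ≅ ResidueField R` compatible with `R → κ(𝔪)` and `residue` (that of `exists_residueFieldIso_of_eq_closedPoint`).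
[folklore] -/
theorem residueFieldMapFixed_comp_iso (θ : R →+* R) [IsLocalHom θ]
    (e : (Spec (.of R)).residueField (closedPoint R) ≅ CommRingCat.of (ResidueField R))
    (he : (Scheme.ΓSpecIso (.of R)).inv ≫ (Spec (.of R)).Γevaluation (closedPoint R) ≫ e.hom =
      CommRingCat.ofHom (residue R)) :
    ((Spec (.of R)).residueFieldCongr (specMap_base_closedPoint R θ)).inv ≫
        (Spec.map (CommRingCat.ofHom θ)).residueFieldMap (closedPoint R) ≫ e.hom =
      e.hom ≫ CommRingCat.ofHom (ResidueField.map θ) := by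
  haveI : (closedPoint R).asIdeal.IsMaximal := maximalIdeal.isMaximal R
  have hsurj : Function.Surjective
      ((Scheme.ΓSpecIso (.of R)).inv ≫ (Spec (.of R)).Γevaluation (closedPoint R)).hom :=
    ΓtoResidueField_surjective_of_isMaximal R (closedPoint R)
  -- both sides agree after the surjection `R → κ(𝔪)`
  have h1 : (Scheme.ΓSpecIso (.of R)).inv ≫ (Spec (.of R)).Γevaluation (closedPoint R) ≫
      ((Spec (.of R)).residueFieldCongr (specMap_base_closedPoint R θ)).inv ≫
        (Spec.map (CommRingCat.ofHom θ)).residueFieldMap (closedPoint R) ≫ e.hom =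
      CommRingCat.ofHom ((residue R).comp θ) := by
    rw [Γevaluation_comp_residueFieldCongr_inv_assoc, Scheme.Γevaluation_naturality_assoc,
      ← Scheme.ΓSpecIso_inv_naturality_assoc, he, ← CommRingCat.ofHom_comp]
  have h2 : (Scheme.ΓSpecIso (.of R)).inv ≫ (Spec (.of R)).Γevaluation (closedPoint R) ≫ e.hom ≫
      CommRingCat.ofHom (ResidueField.map θ) = CommRingCat.ofHom ((residue R).comp θ) := by
    rw [← Category.assoc ((Spec (.of R)).Γevaluation (closedPoint R)), ← Category.assoc, he,
      ← CommRingCat.ofHom_comp]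
    exact congrArg CommRingCat.ofHom (RingHom.ext fun r => IsLocalRing.ResidueField.map_residue θ r)
  ext c
  obtain ⟨r, rfl⟩ := hsurj c
  have h1' := congrArg (fun φ => φ.hom r) h1
  have h2' := congrArg (fun φ => φ.hom r) h2
  simp only [CommRingCat.hom_comp, RingHom.comp_apply] at h1' h2'
  simp only [CommRingCat.hom_comp, RingHom.comp_apply]
  rw [h1', h2']

variable (S : Type u) [CommRing S] [IsLocalRing S] [Algebra R S] [IsLocalHom (algebraMap R S)]

/-- The two residue-field identifications at the closed points of `Spec S → Spec R` — `κ(g 𝔪_S) ≅ ResidueField R`,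
`κ(𝔪_S) ≅ ResidueField S`, the latter compatible with `S → κ(𝔪_S)` and `residue` — carrying the residue field map of
`Spec S → Spec R` to `ResidueField R → ResidueField S` (re-derivation of `exists_residueFieldMap_compat` keeping the
characterisation of the second isomorphism). [folklore] -/
theorem exists_residueField_isos (g : Spec (.of S) ⟶ Spec (.of R))
    (hg : g = Spec.map (CommRingCat.ofHom (algebraMap R S))) :
    ∃ (eR : (Spec (.of R)).residueField (g.base (closedPoint S)) ≅ CommRingCat.of (ResidueField R))
      (eS : (Spec (.of S)).residueField (closedPoint S) ≅ CommRingCat.of (ResidueField S)),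
      (Scheme.ΓSpecIso (.of S)).inv ≫ (Spec (.of S)).Γevaluation (closedPoint S) ≫ eS.hom =
          CommRingCat.ofHom (residue S) ∧
        g.residueFieldMap (closedPoint S) ≫ eS.hom =
          eR.hom ≫ CommRingCat.ofHom (algebraMap (ResidueField R) (ResidueField S)) := by
  subst hg
  set g := Spec.map (CommRingCat.ofHom (algebraMap R S)) with hg
  obtain ⟨eR, heR⟩ := exists_residueFieldIso_of_eq_closedPoint R (g.base (closedPoint S)) (specMap_closedPoint R S)
  obtain ⟨eS, heS⟩ := exists_residueFieldIso_of_eq_closedPoint S (closedPoint S) rfl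
  refine ⟨eR, eS, heS, ?_⟩
  haveI : (g.base (closedPoint S)).asIdeal.IsMaximal := by
    rw [specMap_closedPoint R S]; exact maximalIdeal.isMaximal R
  have hsurj := ΓtoResidueField_surjective_of_isMaximal R (g.base (closedPoint S))
  have h1 : (Scheme.ΓSpecIso (.of R)).inv ≫ (Spec (.of R)).Γevaluation (g.base (closedPoint S)) ≫
      g.residueFieldMap (closedPoint S) ≫ eS.hom = CommRingCat.ofHom ((residue S).comp (algebraMap R S)) := by
    rw [Scheme.Γevaluation_naturality_assoc, hg, ← Scheme.ΓSpecIso_inv_naturality_assoc, heS]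
    rfl
  have h2 : (Scheme.ΓSpecIso (.of R)).inv ≫ (Spec (.of R)).Γevaluation (g.base (closedPoint S)) ≫
      eR.hom ≫ CommRingCat.ofHom (algebraMap (ResidueField R) (ResidueField S)) =
      CommRingCat.ofHom ((residue S).comp (algebraMap R S)) := by
    rw [reassoc_of% heR]
    rfl
  ext c
  obtain ⟨r, rfl⟩ := hsurj c
  have h1' := congrArg (fun φ => φ.hom r) h1
  have h2' := congrArg (fun φ => φ.hom r) h2
  simp only [CommRingCat.hom_comp, RingHom.comp_apply] at h1' h2'
  change (g.residueFieldMap (closedPoint S) ≫ eS.hom).hom _ = (eR.hom ≫ _).hom _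
  simp only [CommRingCat.hom_comp, RingHom.comp_apply]
  rw [h1', h2']

end SpecLocal

/-! ## (T) discharged -/

section Symmetry

variable {S Ŝ : Type u} [CommRing S] [IsLocalRing S] [CommRing Ŝ] [IsLocalRing Ŝ] [Algebra S Ŝ]
  [IsLocalHom (algebraMap S Ŝ)] {X : Scheme.{u}} (π : X ⟶ Spec (.of S))

/-- **The lifted automorphisms are transitive on the fibres of `X ×_S Spec Ŝ → X` over the closed fibre.**  Let
`𝔪_S Ŝ = 𝔪_Ŝ`, `κ(Ŝ)/κ(S)` finite Galois, and `ρ : H → Aut_S(Ŝ)` with every `κ(S)`-automorphism of `κ(Ŝ)` a residue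
map of some `ρ h`.  For points `ζ, ζ'` of `X ×_S Spec Ŝ` with the same image `x ∈ X` over the closed point of `S`
there are `h` and a lift `e : X ×_S Spec Ŝ ≅ X ×_S Spec Ŝ` of `ρ h` (`e ≫ fst = fst`, `e ≫ snd = snd ≫ Spec (ρ h)`) with
`e ζ = ζ'`. [folklore] -/
theorem exists_iso_apply_eq_of_residue_surjective
    [FiniteDimensional (ResidueField S) (ResidueField Ŝ)] [IsGalois (ResidueField S) (ResidueField Ŝ)]
    (hmax : (maximalIdeal S).map (algebraMap S Ŝ) = maximalIdeal Ŝ)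
    {H : Type*} [Group H] (ρ : H →* (Ŝ ≃ₐ[S] Ŝ))
    (hres : ∀ σ' : ResidueField Ŝ ≃ₐ[ResidueField S] ResidueField Ŝ, ∃ h : H, ∀ s : Ŝ,
      residue Ŝ (ρ h s) = σ' (residue Ŝ s))
    (ι : Spec (.of Ŝ) ⟶ Spec (.of S)) (hι : ι = Spec.map (CommRingCat.ofHom (algebraMap S Ŝ)))
    {ζ ζ' : ↑(pullback π ι)} (hζ : π.base ((pullback.fst π ι).base ζ) = closedPoint S)
    (hζζ' : (pullback.fst π ι).base ζ' = (pullback.fst π ι).base ζ) :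
    ∃ (h : H) (e : pullback π ι ≅ pullback π ι),
      e.hom ≫ pullback.fst π ι = pullback.fst π ι ∧
      e.hom ≫ pullback.snd π ι = pullback.snd π ι ≫ Spec.map (CommRingCat.ofHom (ρ h).toRingEquiv.toRingHom) ∧
      e.hom.base ζ = ζ' := by
  classical
  have Hsq : IsPullback (pullback.fst π ι) (pullback.snd π ι) π (Spec.map (CommRingCat.ofHom (algebraMap S Ŝ))) := by
    rw [← hι]; exact IsPullback.of_hasPullback π ι
  -- every point over the closed fibre of `π` lies over the closed point of `Ŝ`
  have hg : ι.base ⁻¹' {closedPoint S} = {closedPoint Ŝ} := by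
    rw [hι]; exact preimage_closedPoint_eq_of_map_maximalIdeal S Ŝ hmax
  have hy : ∀ ξ : ↑(pullback π ι), π.base ((pullback.fst π ι).base ξ) = closedPoint S →
      (pullback.snd π ι).base ξ = closedPoint Ŝ := fun ξ hξ =>
    (base_eq_closedPoint_iff_of_sq π (pullback.snd π ι) (pullback.fst π ι) ι pullback.condition hg ξ).mpr hξ
  have hyζ : (pullback.snd π ι).base ζ = closedPoint Ŝ := hy ζ hζ
  have hyζ' : (pullback.snd π ι).base ζ' = closedPoint Ŝ := hy ζ' (by rw [hζζ']; exact hζ)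
  -- the triplet `(x, 𝔪_Ŝ)`
  set x := (pullback.fst π ι).base ζ with hx
  have hxy : π.base x = ι.base (closedPoint Ŝ) := by
    rw [← hyζ, hx]
    change (pullback.fst π ι ≫ π).base ζ = (pullback.snd π ι ≫ ι).base ζ
    rw [pullback.condition]
  set T : Triplet π ι := Triplet.mk' x (closedPoint Ŝ) hxy with hT
  -- the lifts `e h` of `ρ h`, the endomorphisms `u h = Spec (ρ h)` of `Spec Ŝ` over `Spec S`
  choose e he1 he2 using fun h : H =>
    exists_iso_baseChange_of_algEquiv π (pullback.snd π ι) (pullback.fst π ι) Hsq (ρ h)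
  haveI hloc : ∀ h : H, IsLocalHom (ρ h).toRingEquiv.toRingHom := fun h => isLocalHom_ringEquiv _
  have hu : ∀ h : H, Spec.map (CommRingCat.ofHom (ρ h).toRingEquiv.toRingHom) ≫ ι = ι := fun h => by
    rw [hι]; exact specMap_algEquiv_comp (ρ h)
  have hyu : ∀ h : H, (Spec.map (CommRingCat.ofHom (ρ h).toRingEquiv.toRingHom)).base (closedPoint Ŝ) =
      closedPoint Ŝ := fun h => specMap_base_closedPoint Ŝ _
  -- their residue endomorphisms `ū h` at `𝔪_Ŝ` and the endomorphisms `τ h = id ⊗ ū h` of `κ(x) ⊗ κ(𝔪_Ŝ)`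
  set ū : H → ((Spec (.of Ŝ)).residueField (closedPoint Ŝ) ⟶ (Spec (.of Ŝ)).residueField (closedPoint Ŝ)) :=
    fun h => ((Spec (.of Ŝ)).residueFieldCongr (hyu h)).inv ≫
      (Spec.map (CommRingCat.ofHom (ρ h).toRingEquiv.toRingHom)).residueFieldMap (closedPoint Ŝ) with hū
  have hū1 : ∀ h, Spec.map (ū h) ≫ (Spec (.of Ŝ)).fromSpecResidueField (closedPoint Ŝ) =
      (Spec (.of Ŝ)).fromSpecResidueField (closedPoint Ŝ) ≫
        Spec.map (CommRingCat.ofHom (ρ h).toRingEquiv.toRingHom) := fun h =>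
    specMap_residueFieldMapFixed_comp _ (hyu h)
  have hū2 : ∀ h, ι.residueFieldMap (closedPoint Ŝ) ≫ ū h = ι.residueFieldMap (closedPoint Ŝ) := fun h =>
    residueFieldMap_comp_residueFieldMapFixed _ (hu h) (hyu h)
  choose τ hτ1 hτ2 using fun h : H => exists_tensor_map (f := π) (g := ι) hxy (ū h) (hū2 h)
  have hcomp : ∀ h, T.SpecTensorTo ≫ (e h).hom = Spec.map (τ h) ≫ T.SpecTensorTo := fun h =>
    specTensorTo_comp_eq T _ (e h).hom (he1 h) (he2 h) (ū h) (hū1 h) (τ h) (hτ1 h) (hτ2 h)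
  -- the residue fields at the closed points, and `ū h ↔ κ(ρ h)`
  obtain ⟨ek, eK, heK, hcompat⟩ := exists_residueField_isos S Ŝ ι hι
  have hū3 : ∀ h, ū h ≫ eK.hom = eK.hom ≫ CommRingCat.ofHom (ResidueField.map (ρ h).toRingEquiv.toRingHom) :=
    fun h => by
      rw [hū, Category.assoc]
      exact residueFieldMapFixed_comp_iso Ŝ _ eK heK
  have hū4 : ∀ σ' : ResidueField Ŝ ≃ₐ[ResidueField S] ResidueField Ŝ, ∃ h,
      ū h ≫ eK.hom = eK.hom ≫ CommRingCat.ofHom (σ' : ResidueField Ŝ →+* ResidueField Ŝ) := fun σ' => by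
    obtain ⟨h, hh⟩ := hres σ'
    refine ⟨h, ?_⟩
    rw [hū3]
    congr 2
    refine Ideal.Quotient.ringHom_ext (RingHom.ext fun s => ?_)
    exact hh s
  -- transitivity on the fibre over `(x, 𝔪_Ŝ)`
  have htrans : ∀ p q : Spec T.tensor, ∃ h, (Spec.map (τ h)).base p = q := fun p q =>
    exists_specMap_pushout_eq (F := ↑(X.residueField x))
      (((Spec (.of S)).residueFieldCongr T.hx).inv ≫ π.residueFieldMap T.x)
      (((Spec (.of S)).residueFieldCongr T.hy).inv ≫ ι.residueFieldMap T.y) ek eK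
      (by
        change (𝟙 _ ≫ ι.residueFieldMap (closedPoint Ŝ)) ≫ eK.hom = _
        rw [Category.id_comp, hcompat]
        rfl)
      ū hū4 τ hτ1 hτ2 p q
  obtain ⟨h, hh⟩ := exists_base_eq_of_transitive T (fun h => (e h).hom) τ hcomp htrans (ζ := ζ) (ζ' := ζ') rfl hyζ
    hζζ' hyζ'
  exact ⟨h, e h, he1 h, he2 h, hh⟩

/-- **BC-4b hypothesis (T) discharged** — the `hsymm` of `…NoZenoGaloisAscent.isMinimalResolution_of_flat_of_symmetric`
for `X_B := X ×_S Spec Ŝ`, from res-D-pv-039's symmetry package. [this work] -/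
theorem hsymm_of_residue_surjective
    [FiniteDimensional (ResidueField S) (ResidueField Ŝ)] [IsGalois (ResidueField S) (ResidueField Ŝ)]
    (hmax : (maximalIdeal S).map (algebraMap S Ŝ) = maximalIdeal Ŝ)
    {H : Type*} [Group H] (ρ : H →* (Ŝ ≃ₐ[S] Ŝ))
    (hres : ∀ σ' : ResidueField Ŝ ≃ₐ[ResidueField S] ResidueField Ŝ, ∃ h : H, ∀ s : Ŝ,
      residue Ŝ (ρ h s) = σ' (residue Ŝ s))
    (ι : Spec (.of Ŝ) ⟶ Spec (.of S)) (hι : ι = Spec.map (CommRingCat.ofHom (algebraMap S Ŝ))) :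
    ∀ ζ ζ' : ↑(pullback π ι),
      (pullback.fst π ι).base ζ ∈ Literature.AlgebraicGeometry.Resolution.excCurvePoints π →
        (pullback.fst π ι).base ζ' = (pullback.fst π ι).base ζ →
        ∃ (e : pullback π ι ≅ pullback π ι) (θ : Ŝ ≃+* Ŝ),
          e.hom ≫ pullback.snd π ι = pullback.snd π ι ≫ Spec.map (CommRingCat.ofHom θ.toRingHom) ∧
            e.hom.base ζ = ζ' := by
  intro ζ ζ' hζ hζζ'
  obtain ⟨h, e, -, he2, he⟩ := exists_iso_apply_eq_of_residue_surjective π hmax ρ hres ι hι hζ.1 hζζ'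
  exact ⟨e, (ρ h).toRingEquiv, he2, he⟩

end Symmetry

end Summit.ResolutionOfSingularities.ResolutionOfSingularities.Theorems.NoZeno.ExcCount

end
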